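import Summits.BirchSwinnertonDyer.BirchSwinnertonDyer.Theorems.PrintX9RescalingTowerNoPTorsion
import Summits.BirchSwinnertonDyer.BirchSwinnertonDyer.Theorems.Rank1ResidualX9Defs
import HarnessLib

/-!
# Stubs `stub_heegnerModule_zsmul_divisible` (skeleton v3-scaling, x9-p2, sha `1ef40074024b…`) and
# `stub_rescaling` (skeleton v3, LEAD x9-p1, sha `48007b5deb32…`) of line `torsion-depth-light-ofprint` on
# crux `PrintX9.HowardContainmentLightFrameOfPrint` (stmt-BirchSwinnertonDyer-25235), BY SIGNATURE

Both reshapes of the line (LEAD 06:03Z; x9-p2 06:41Z) isolate the same tree-internal step of the SCALING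
REDUCTION, which parts I–IV of the rescaling helper prove (`PrintX9RescalingCompactSelmerDivision`,
`PrintX9RescalingCharIdealPow`, `PrintX9HowardContainmentOfPrintRescaling`, `PrintX9RescalingTowerNoPTorsion`):

* §1 `fixedGeomPoints_eq_zero_of_smul_eq_zero_of_noPTorsion` — **`E(K)[p] = 0 ⟹ E(K_n)[p] = 0` for every
  layer of ANY `ℤ_p`-extension** (no irreducibility): the `Gal(K̄/K_n)`-fixed part `M` of `E[p]` is a finite
  `p`-group (`#E[p] = p²`) on which `γ` (a topological generator, from `κ.surjective`) acts through a cyclic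
  `p`-group (`γ^{pⁿ} ∈ Gal(K̄/K_n)`); its fixed points are `Γ_K`-fixed (`ZpDescent.exists_decomp`), hence come
  from `E(K)[p] = 0` (`exists_toGeomPoints_eq_of_forall_smul_eq`); so `#M ≡ 1 (mod p)`
  (`IsPGroup.card_modEq_card_fixedPoints`) and `#M ∣ p²`, i.e. `M = 0`.
* §2 `Stmt.stub_heegnerModule_zsmul_divisible` (x9-p2's registered text VERBATIM, re-homed) and
  `stub_heegnerModule_zsmul_divisible`: `ℋ_∞(p^c • F) ⊆ (p^c) · ℋ_∞(F)` under `E(K)[p] = 0` — by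
  `heegnerModule_zsmul_pow_le` (part III) with §1.
* §3 `exists_nonTorsion_mem_of_finrank_eq_one` (rank bookkeeping), `Stmt.stub_rescaling` (the LEAD's
  registered text VERBATIM, re-homed) and `stub_rescaling`: the `μ`-blind promotion AS TYPED — by
  `howardContainment_of_localized_family_of_hasIrreducibleModPGaloisRep` (part IV).

The statements are re-homed under this Theorems-side namespace because the skeletons are `Cruxes/` work files
(not importable from `Theorems/`); the texts are syntactically identical under the same `open`s (sbx9
precedent p606505). HONEST FRAMING: kernel-valid AS TYPED; per the cell's FINDING PIN-1 / ruling R0 the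
promotion is NOT route currency (the typed `∃ F` does not pin the parametrisation) — it is the kernel witness
that the unpinned containment is `μ`-blind; the divisibility stub is plain tree-internal typing. «beyond-print
theorem»: no. No summit statement is proved; BSD is not proved by any of this.

References: B. Perrin-Riou, Bull. SMF 115 (1987) §0–§1; B. Howard, Compositio 140 (2004) §1, §3.3;
F. Castella, G. Grossi, J. Lee, C. Skinner, Invent. Math. 227 (2022) §3.2 (h1), Thm. 4.1.3, Remark after
Conj. A; J.-P. Serre, *Local Fields* IX §1 (fixed points of `p`-groups).
-/

set_option linter.dupNamespace false
set_option autoImplicit false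

noncomputable section

open scoped Classical

universe u

open WeierstrassCurve Literature.NumberTheory.EllipticCurves

namespace Summit.BirchSwinnertonDyer.BirchSwinnertonDyer.Theorems.PrintX9Rescaling

/-! ## §1 `E(K)[p] = 0 ⟹ E(K_n)[p] = 0` along any `ℤ_p`-extension -/

section NoPTorsionTower

variable {K : Type u} [Field K] [NumberField K] (V : WeierstrassCurve K) [V.IsElliptic]
  {p : ℕ} [Fact p.Prime] (κ : ZpExtension K p)

/-- **`E(K)[p] = 0 ⟹ E(K_n)[p] = 0` for every layer `K_n` of a `ℤ_p`-extension of the number field `K`**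
(`K_n/K` is a `p`-extension): a geometric point fixed by `Gal(K̄/K_n)` and killed by `p` is `0`. Proof by
counting: the `Gal(K̄/K_n)`-fixed part of `E[p]` has order dividing `p²` and congruent mod `p` to the number
of fixed points of a topological generator `γ` acting through the cyclic `p`-group `⟨γ⟩/⟨γ^{pⁿ}⟩`; those fixed
points are `Γ_K`-fixed, hence in `E(K)[p] = 0`. [cite: CastellaGrossiLeeSkinner2022, §3.2 (standing hypothesis (h1) E(K)[p] = 0)]
[cite: GrossLMS1991, §2 (E(K)[p] = 0)] -/
theorem fixedGeomPoints_eq_zero_of_smul_eq_zero_of_noPTorsion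
    (hE : ∀ Q : V.toAffine.Point, p • Q = 0 → Q = 0) (n : ℕ)
    {P : geomPoints V} (hP : P ∈ V.fixedGeomPoints (κ.layerSubgroup n)) (hpP : (p : ℤ) • P = 0) :
    P = 0 := by
  have hp := (Fact.out : p.Prime)
  -- a topological generator
  obtain ⟨γ, hγ⟩ : ∃ γ : Field.absoluteGaloisGroup K, κ.IsTopGenerator γ :=
    κ.surjective (Multiplicative.ofAdd 1)
  have hγpn : γ ^ p ^ n ∈ κ.layerSubgroup n := by
    have hγ' : κ γ = Multiplicative.ofAdd 1 := hγ
    rw [ZpExtension.mem_layerSubgroup, map_pow, hγ', ← ofAdd_nsmul, toAdd_ofAdd, nsmul_eq_mul,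
      mul_one, Nat.cast_pow]
  have hPfix : ∀ σ ∈ κ.layerSubgroup n, σ • P = P := (V.mem_fixedGeomPoints_iff P).1 hP
  -- Γ_K-fixed `p`-torsion geometric points vanish (Galois descent + `E(K)[p] = 0`)
  have hdesc : ∀ R : geomPoints V, (∀ τ : Field.absoluteGaloisGroup K, τ • R = R) →
      (p : ℤ) • R = 0 → R = 0 := by
    intro R hR hpR
    obtain ⟨Q, hQ⟩ := exists_toGeomPoints_eq_of_forall_smul_eq V hR
    have hQ0 : Q = 0 := hE Q (toGeomPoints_injective V (by
      rw [map_nsmul, hQ, map_zero, ← natCast_zsmul, hpR]))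
    rw [← hQ, hQ0, map_zero]
  -- the `Gal(K̄/K_n)`-fixed part `M` of `E[p]`
  let H₁ : AddSubgroup (geomTorsion V (p : ℤ)) :=
    { carrier := {Q | ∀ σ ∈ κ.layerSubgroup n, σ • Q = Q}
      zero_mem' := fun σ _ ↦ smul_zero σ
      add_mem' := fun {a b} ha hb σ hσ ↦ by rw [smul_add, ha σ hσ, hb σ hσ]
      neg_mem' := fun {a} ha σ hσ ↦ by rw [smul_neg, ha σ hσ] }
  have hH₁stab : ∀ τ : Field.absoluteGaloisGroup K, ∀ Q ∈ H₁, τ • Q ∈ H₁ := by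
    intro τ Q hQ σ hσ
    have hconj : τ⁻¹ * σ * τ ∈ κ.layerSubgroup n := by
      have := (κ.layerSubgroup_normal n).conj_mem σ hσ τ⁻¹
      rwa [inv_inv] at this
    calc σ • τ • Q = τ • ((τ⁻¹ * σ * τ) • Q) := by
          rw [← mul_smul, ← mul_smul, ← mul_assoc, ← mul_assoc, mul_inv_cancel, one_mul]
      _ = τ • Q := by rw [hQ _ hconj]
  -- cardinalities
  have hcardE : Nat.card (geomTorsion V (p : ℤ)) = p ^ 2 :=
    V.card_torsionPoints_eq_sq_holds (AlgebraicClosure K) (n := p) (by exact_mod_cast hp.ne_zero)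
  haveI : Finite (geomTorsion V (p : ℤ)) := Nat.finite_of_card_ne_zero (by
    rw [hcardE]; exact pow_ne_zero _ hp.ne_zero)
  have hcardM : Nat.card H₁ ∣ p ^ 2 := hcardE ▸ H₁.card_addSubgroup_dvd_card
  -- the permutation of `M` induced by `γ` and the cyclic `p`-group it generates
  let g : Equiv.Perm H₁ :=
    { toFun := fun Q ↦ ⟨γ • Q.1, hH₁stab γ Q.1 Q.2⟩
      invFun := fun Q ↦ ⟨γ⁻¹ • Q.1, hH₁stab γ⁻¹ Q.1 Q.2⟩
      left_inv := fun Q ↦ Subtype.ext (by simp [smul_smul])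
      right_inv := fun Q ↦ Subtype.ext (by simp [smul_smul]) }
  have hgk : ∀ (k : ℕ) (Q : H₁), ((g ^ k) Q : H₁).1 = (γ ^ k) • Q.1 := by
    intro k
    induction k with
    | zero => intro Q; rw [pow_zero, pow_zero, one_smul, Equiv.Perm.one_apply]
    | succ k ih => intro Q; rw [pow_succ, Equiv.Perm.mul_apply, ih, pow_succ, mul_smul]; rfl
  have hgpow : g ^ p ^ n = 1 := by
    refine Equiv.ext fun Q ↦ Subtype.ext ?_
    rw [hgk, Equiv.Perm.one_apply]
    exact Q.2 _ hγpn
  have hGp : IsPGroup p (Subgroup.zpowers g) := by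
    intro x
    refine ⟨n, Subtype.ext ?_⟩
    obtain ⟨z, hz⟩ := Subgroup.mem_zpowers_iff.mp x.2
    rw [Subgroup.coe_pow, Subgroup.coe_one, ← hz, ← zpow_natCast, ← zpow_mul, mul_comm, zpow_mul,
      zpow_natCast, hgpow, one_zpow]
  -- its fixed points are `Γ_K`-fixed `p`-torsion points, hence `0`
  have hfix : MulAction.fixedPoints (Subgroup.zpowers g) H₁ = {0} := by
    ext Q
    rw [MulAction.mem_fixedPoints, Set.mem_singleton_iff]
    constructor
    · intro hQ
      have hγQ : γ • (Q : geomTorsion V (p : ℤ)) = Q := by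
        have := hQ ⟨g, Subgroup.mem_zpowers g⟩
        rw [Subgroup.mk_smul, Equiv.Perm.smul_def] at this
        exact congrArg Subtype.val this
      have hγk : ∀ k : ℕ, (γ ^ k) • (Q : geomTorsion V (p : ℤ)) = Q := fun k ↦ by
        induction k with
        | zero => rw [pow_zero, one_smul]
        | succ k ih => rw [pow_succ, mul_smul, hγQ, ih]
      have hall : ∀ τ : Field.absoluteGaloisGroup K, τ • ((Q : geomTorsion V (p : ℤ)) : geomPoints V) =
          ((Q : geomTorsion V (p : ℤ)) : geomPoints V) := by
        intro τ
        obtain ⟨k, -, m, hm, u, hu, rfl⟩ :=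
          ZpDescent.exists_decomp (κ := κ) hγ (κ.layerSubgroup n) (κ.isOpen_layerSubgroup n) τ
        have h1 := congrArg Subtype.val (Q.2 u hu)
        have h2 := congrArg Subtype.val (Q.2 m (κ.kerSubgroup_le_layerSubgroup n hm))
        have h3 := congrArg Subtype.val (hγk k)
        simp only [AddSubgroup.torsionBy.coe_smul] at h1 h2 h3
        rw [mul_smul, mul_smul, h1, h2, h3]
      have h0 := hdesc _ hall ((V.mem_geomTorsion_iff (p : ℤ) _).1 (Q : geomTorsion V (p : ℤ)).2)
      exact Subtype.ext (Subtype.ext h0)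
    · rintro rfl x
      obtain ⟨z, hz⟩ := Subgroup.mem_zpowers_iff.mp x.2
      rw [Subgroup.smul_def, Equiv.Perm.smul_def, ← hz]
      -- `g ^ z` fixes `0`
      have h0g : ∀ k : ℕ, (g ^ k) 0 = 0 := fun k ↦
        Subtype.ext (by rw [hgk]; exact smul_zero _)
      rcases Int.eq_nat_or_neg z with ⟨k, rfl | rfl⟩
      · rw [zpow_natCast]; exact h0g k
      · rw [zpow_neg, zpow_natCast, Equiv.Perm.inv_eq_iff_eq]; exact (h0g k).symm
  -- counting: `#M ≡ 1 (mod p)` and `#M ∣ p²` force `#M = 1`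
  have hmod : Nat.card H₁ ≡ 1 [MOD p] := by
    have h := hGp.card_modEq_card_fixedPoints H₁
    have h1 : Nat.card (MulAction.fixedPoints (Subgroup.zpowers g) H₁) = 1 := by
      rw [hfix]; exact Nat.card_unique
    rwa [h1] at h
  have hcard1 : Nat.card H₁ = 1 := by
    obtain ⟨k, hk, hk'⟩ := (Nat.dvd_prime_pow hp).1 hcardM
    rcases k with _ | k
    · simpa using hk'
    · exfalso
      have hdvd : p ∣ Nat.card H₁ := by rw [hk', pow_succ]; exact dvd_mul_left p _
      have h1 : p ∣ 1 := (Nat.modEq_zero_iff_dvd.mp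
        (hmod.symm.trans (Nat.modEq_zero_iff_dvd.mpr hdvd)))
      exact hp.one_lt.ne' (Nat.dvd_one.mp h1)
  haveI : Subsingleton H₁ := (Nat.card_eq_one_iff_unique.mp hcard1).1
  -- conclude
  let Pm : H₁ := ⟨⟨P, (V.mem_geomTorsion_iff (p : ℤ) P).2 hpP⟩, fun σ hσ ↦ Subtype.ext (hPfix σ hσ)⟩
  have : Pm = 0 := Subsingleton.elim _ _
  exact congrArg (fun Q : H₁ ↦ ((Q : geomTorsion V (p : ℤ)) : geomPoints V)) this

end NoPTorsionTower

/-! ## §2 Stub `stub_heegnerModule_zsmul_divisible` (skeleton v3-scaling), by name -/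

section Divisible

/-- **REGISTERED STUB (skeleton v3-scaling, x9-p2) `stub_heegnerModule_zsmul_divisible` — levelwise
`p`-divisibility in the compact Selmer limit**, VERBATIM the skeleton's
`TorsionDepthLight.Stmt.stub_heegnerModule_zsmul_divisible` (crux workfile
`Cruxes/HowardContainmentLightFrameOfPrint/Lines/torsion_depth_light_ofprint_v3_scaling.lean`, sha
`1ef40074024b…`), re-homed under this Theorems-side namespace (not importable; syntactically identical under
the same `open`s). A statement abbreviation WITH a kernel-closed witness below, not a named fact. -/
abbrev Stmt.stub_heegnerModule_zsmul_divisible : Prop :=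
    ∀ (N : ℕ) [NeZero N] (W : WeierstrassCurve ℚ) [W.IsElliptic] (p : ℕ) [Fact p.Prime]
      (K : Type) [Field K] [NumberField K],
      (∀ Q : (W.baseChange K).toAffine.Point, p • Q = 0 → Q = 0) →
      ∀ (κ : ZpExtension K p) (γ : Field.absoluteGaloisGroup K) (jbar : AlgebraicClosure K →+* ℂ)
        (D : (W.baseChange K).LambdaAdicSelmerData κ γ) (F : HeegnerFamily N W K κ jbar)
        (c : ℕ) (hc : ((p : ℤ) ^ c) ≠ 0),
      ∀ s ∈ heegnerModule D (F.zsmulSelf ((p : ℤ) ^ c) hc),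
        ∃ t ∈ heegnerModule D F, s = ((p : IwasawaAlgebra p) ^ c) • t

/-- **Stub `stub_heegnerModule_zsmul_divisible`, BY SIGNATURE**: `ℋ_∞(p^c • F) ⊆ (p^c) · ℋ_∞(F)` for every
`Λ`-adic Selmer datum, Heegner family and `c`, granted `E(K)[p] = 0` — `heegnerModule_zsmul_pow_le`
(division by `p^c` in `𝔖_p(K_∞)`, part III) with `E(K_n)[p] = 0` along the tower from §1. Tree-internal
typing; «beyond-print theorem»: no. [cite: PerrinRiou1987BSMF, §0 pp. 401–402 (S_p(L), 𝔖_p)] [cite: Howard2004HeegnerKolyvagin, §3.3 (𝐇 = lim← H_k)] -/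
theorem stub_heegnerModule_zsmul_divisible : Stmt.stub_heegnerModule_zsmul_divisible := by
  intro N _ W _ p _ K _ _ hE κ γ jbar D F c hc s hs
  exact heegnerModule_zsmul_pow_le D F (F.Dt.zsmul ((p : ℤ) ^ c) hc) c (F.Dt.φ_zsmul hc)
    (fun n P hP hpP ↦ fixedGeomPoints_eq_zero_of_smul_eq_zero_of_noPTorsion (W.baseChange K) κ hE n hP hpP)
    hs

end Divisible

/-! ## §3 Stub `stub_rescaling` (skeleton v3, LEAD), by name -/

/-- **A submodule with torsion cokernel inside a finitely generated rank-one module has a non-torsion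
element** (over the domain `Λ`): `rank(𝔖/ℋ) + rank ℋ = rank 𝔖 = 1` and `rank(𝔖/ℋ) = 0` (torsion), so
`rank ℋ = 1 ≠ 0`, i.e. `ℋ` is not torsion. [folklore] -/
theorem exists_nonTorsion_mem_of_finrank_eq_one {p : ℕ} [Fact p.Prime] {S : Type*} [AddCommGroup S]
    [Module (IwasawaAlgebra p) S] [Module.Finite (IwasawaAlgebra p) S]
    (hS1 : Module.finrank (IwasawaAlgebra p) S = 1) (H : Submodule (IwasawaAlgebra p) S)
    (htor : Module.IsTorsion (IwasawaAlgebra p) (S ⧸ H)) :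
    ∃ h ∈ H, ∀ c : IwasawaAlgebra p, c • h = 0 → c = 0 := by
  have hS : Module.rank (IwasawaAlgebra p) S = 1 := by
    rw [← Module.finrank_eq_rank, hS1, Nat.cast_one]
  have hq : Module.rank (IwasawaAlgebra p) (S ⧸ H) = 0 := rank_eq_zero_iff_isTorsion.mpr htor
  have hH : Module.rank (IwasawaAlgebra p) H = 1 := by
    have hsum := rank_quotient_add_rank_of_isDomain H
    rwa [hq, zero_add, hS] at hsum
  have hnt : ¬ Module.IsTorsion (IwasawaAlgebra p) H := by
    intro h
    have h0 : Module.rank (IwasawaAlgebra p) H = 0 := rank_eq_zero_iff_isTorsion.mpr h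
    rw [hH] at h0
    exact one_ne_zero h0
  simp only [Module.IsTorsion, not_forall, not_exists] at hnt
  obtain ⟨x, hx⟩ := hnt
  refine ⟨x, x.2, fun c hc ↦ ?_⟩
  by_contra hc0
  refine hx ⟨c, mem_nonZeroDivisors_of_ne_zero hc0⟩ (Subtype.ext ?_)
  rw [Submonoid.mk_smul, Submodule.coe_smul, Submodule.coe_zero]
  exact hc

/-- **REGISTERED STUB (skeleton v3) `stub_rescaling` — the `μ`-blind promotion AS TYPED**, VERBATIM the
skeleton's `TorsionDepthLight.Stmt.stub_rescaling` (crux workfile of stmt-BirchSwinnertonDyer-25235, sha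
`48007b5deb32…`), re-homed under this Theorems-side namespace (the skeleton is not importable from
`Theorems/`; the two texts are syntactically identical under the same `open`, hence interchangeable by
`Iff.rfl`). A statement abbreviation WITH a kernel-closed witness in this module (`stub_rescaling`), not a
named fact. -/
abbrev Stmt.stub_rescaling : Prop :=
    ∀ (W : WeierstrassCurve ℚ) [W.IsElliptic] [W.IsGloballyMinimal] (p : ℕ) [Fact p.Prime]
      [NeZero (W.conductorNorm ℤ)] (K : Type) [Field K] [NumberField K],
      Summit.BirchSwinnertonDyer.BirchSwinnertonDyer.Rank1Residual.ClassX9 W p →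
      IsImaginaryQuadratic K → Odd (NumberField.discr K) → NumberField.discr K ≠ -3 →
      SatisfiesHeegnerHypothesis (W.conductorNorm ℤ) K → SatisfiesHeegnerHypothesis p K →
      (W.baseChange K).HasIrreducibleModPGaloisRep p →
      ∀ (κ : ZpExtension K p), κ.IsAnticyclotomic → ∀ (γ : Field.absoluteGaloisGroup K),
      κ.IsTopGenerator γ →
      ∀ (jbar : AlgebraicClosure K →+* ℂ) (D : (W.baseChange K).LambdaAdicSelmerData κ γ)
        (F₀ : HeegnerFamily (W.conductorNorm ℤ) W K κ jbar) (X : (W.baseChange K).SelmerDualData κ γ),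
      Module.Finite (IwasawaAlgebra p) D.S → Module.finrank (IwasawaAlgebra p) D.S = 1 →
      Module.IsTorsion (IwasawaAlgebra p) (D.S ⧸ heegnerModule D F₀) →
      (∃ m : ℕ, Ideal.span {((p : IwasawaAlgebra p) ^ m)} * heegnerCharIdeal D F₀ ^ 2 ≤
        Module.charIdeal (IwasawaAlgebra p) (Submodule.torsion (IwasawaAlgebra p) X.X)) →
      ∃ (F : HeegnerFamily (W.conductorNorm ℤ) W K κ jbar),
        heegnerCharIdeal D F ^ 2 ≤
          Module.charIdeal (IwasawaAlgebra p) (Submodule.torsion (IwasawaAlgebra p) X.X)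

/-- **Stub `stub_rescaling` of line `torsion-depth-light-ofprint` (skeleton v3) on crux
`PrintX9.HowardContainmentLightFrameOfPrint` (stmt-BirchSwinnertonDyer-25235), BY SIGNATURE**: the promotion
`howardContainment_of_localized_family_of_hasIrreducibleModPGaloisRep` (`F := p^m • F₀`; levelwise
`p^m`-division in `𝔖_p(K_∞)` from `E(K_n)[p] = 0`, which the frame's (irr_K) gives along the tower;
`I(ℋ_∞(p^m • F₀)) ⊆ (p^m) · I(ℋ_∞(F₀))`), with the non-torsion element of `ℋ_{F₀}` supplied by rank
bookkeeping (`exists_nonTorsion_mem_of_finrank_eq_one`). Kernel-valid as typed; NOT route currency under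
PIN-1 (plan g9 R0). «beyond-print theorem»: no.
[cite: CastellaGrossiLeeSkinner2022, Thm. 4.1.3 ("Moreover") and Remark after Conj. A (with p inverted the terms are invariant under isogenies)] [cite: PerrinRiou1987BSMF, §1 p. 405 (H_∞ depends on the parametrisation π)] -/
theorem stub_rescaling : Stmt.stub_rescaling := by
  intro W _ _ p _ _ K _ _ _ _ _ _ _ _ hirr κ _ γ hγ jbar D F₀ X hfin hrk htor hloc
  obtain ⟨m, hm⟩ := hloc
  haveI : Module.Finite (IwasawaAlgebra p) D.S := hfin
  exact howardContainment_of_localized_family_of_hasIrreducibleModPGaloisRep hirr hγ D X F₀ m hfin htor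
    (exists_nonTorsion_mem_of_finrank_eq_one hrk (heegnerModule D F₀) htor) hm

end Summit.BirchSwinnertonDyer.BirchSwinnertonDyer.Theorems.PrintX9Rescaling

end
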